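import Literature.AnabelianGeometry.EtaleTheta.GalSectThm110iiiV3Knit
import Literature.AnabelianGeometry.EtaleTheta.GalSectDotCCuspOfStructureGroupIsoLaws
import Literature.AnabelianGeometry.EtaleTheta.SettingModelKrullCuspCommTerminalC
import HarnessLib

/-!
# [EtTh] Thm. 1.10 (iii) — the END-KNIT closer of record FED THE PRODUCED CUSP DATUM: (gen) ×2, (sf) ×2 and the base
# splittings DISCHARGED, (ct) ×2 REDUCED to the `ε_±`-criterion (proof-only)

S. Mochizuki, *The étale theta function and its Frobenioid-theoretic manifestations* [EtTh], Publ. RIMS **45** (2009),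
Thm. 1.10 (iii) p. 256 (PRIMS PDF p. 30) [cite: MochizukiEtTh2009, Thm 1.10 (iii) p.30]; S. Mochizuki, *Galois sections in absolute
anabelian geometry* [GalSect], Nagoya Math. J. **179** (2005), §4 p. 33 [cite: MochizukiGalSect2005, §4 p.33]; [SemiAnbd] Thm. 6.5 (ii)
p. 71 (cuspidal decomposition groups are commensurably terminal) [cite: MochizukiSemiAnbd2006, Thm 6.5 (ii) p.71].

abc-iut cell, layer L2, node EtTh:Thm1.10(iii) (K2 sub-DAG `plan/L2/SUBDAG-EtTh-Thm110.md`, residual census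
`plan/L2/K2-RESIDUAL-SIGNATURES.md`); seat abc-iut-w5-d029 (gen 9), abc-iut-L2-lead ROWS #129 R975 / #130 R987 «EtTh:Thm1.10(iii) K2
END-KNIT CENSUS at the DotCCusp datum».  PROOF-ONLY: no definitions, no named facts, no `sorry`.

THE KNIT.  The closer of record `thm110iiiGalSect_of_Xlevel_v3` (abc-iut-w5-d062, `GalSectThm110iiiV3Knit`) carries, per side, the
binders (x) + (ct) + F-0007 + (sf) + base splitting + (gen) + (b3).  This lineage PRODUCED a cusp datum meeting (gen) and (sf) by
construction — `MuTwoSetting.DotCCusp.ofStructureGroupIso e εZ hx hD hS₀ κ` (p454786; `κ : (K^×)^∧ ≃* Ker(res)` = inflation ∘ Kummer,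
p468879 `GalSectCuspTorsorStructureGroupKummer`; laws p473284 `GalSectDotCCuspOfStructureGroupIsoLaws`).  Here the closer is FED that
datum on both sides:

* `ofStructureGroupIso_hCT_iff` — at the produced datum (whose cusp pair is `(inclX D_x, inclX I_x)`) the binder (ct) IS abc-iut-L2-t5's
  `ε_±`-criterion (p450247 `MuTwoSetting.commTerminalC_iff_sqrt_not_mem_dotC`): given `D_x` commensurably terminal in `Π^tp_X`
  ([SemiAnbd] Thm. 6.5 (ii)) and an element `Γ₀ ∈ Π^tp_X` through which `ε_±` conjugates `inclX(D_x)`, (ct) holds over `Π^tp_Ċ = dotC εZ`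
  IFF `g₁ := inclX(Γ₀)·ε_± ∉ Π^tp_Ċ` — an `ε_Z`-CLASS condition (model verdict p450247: true for `ε_Z ≡ a·b`, false for `ε_Z ≡ a` at
  `inversionModelκ′`), not a consequence of `IsAdmissibleEpsZ`;
* **`thm110iiiGalSect_ofStructureGroupIso`** — [EtTh] Thm. 1.10 (iii) AS TYPED (`Thm110iiiGalSect`) for the two produced cusp data,
  from: (x) the `Ẋ`-level cusp transport along `γ_X`; the (ct)-criterion inputs ×2 {`D_x` commensurably terminal, `Γ₀`, `g₁ ∉ Π^tp_Ċ`};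
  F-0007 = [AbsAnab] Lem. 1.3.8 `PreservesGeom` BY NAME with its modelling data; (b3) [GalSect] Cor. 4.12 for the class transports —
  (gen) ×2, (sf) ×2 and the base splittings no longer appear (they are theorems of the produced datum), (μ)/(tf)/(μtor) were discharged in v3;
* `exists_produced_thm110iiiGalSect_refl_of_origins` — INSTANCE COLUMN at a JOINT ORIGIN (`IsEtThOrigin` + `hYcl` + `IsThm16Origin` +
  `IsTateOrigin` + `CuspLaws`, a C-level datum): for the cusp `x` with (P3) and `D_x ≤ Π^tp_Ẍ` there is a produced cusp datum `C` carrying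
  (gen), C7e (1) and (sf) at which the typed Thm. 1.10 (iii) HOLDS for the identity hypothesis structure (`γ = id`; composition of p473284's
  `exists_isGenuineTorsor_hsf_of_origins` with abc-iut-w5-d062's `exists_thm110iiiGalSect_refl`) — the (iii) analogue of the K2 (i)/(ii)
  γ = id instances, at an origin (no carrier of the model zoo inhabits a joint origin).

HONEST FRAMING: bookkeeping over the tree's constructions; every remaining input is a printed inference / cited anabelian result carried BY
NAME ((x) [AbsAnab] Lem. 1.3.9 genre, F-0007, (ct) [SemiAnbd] Thm. 6.5 (ii) + the `ε_±`/cusp tie, (b3) [GalSect] Cor. 4.12), none asserted;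
origin predicates are inhabited only at models; typed ≠ proved; no side taken on [IUTchIII] Cor. 3.12, on which nothing here bears.
-/

namespace Literature.AnabelianGeometry.EtaleTheta

open Literature.AnabelianGeometry.SemiGraphs Literature.AnabelianGeometry.AbsoluteAnabelian GalSect
open scoped Pointwise

namespace MuTwoSetting

namespace DotCCusp

variable {p : ℕ} [Fact p.Prime] {M : MuTwoSetting p}
variable (e : M.CLevelData) (εZ : M.GtpC) {x : M.Pt} (hx : M.IsCusp x) (hD : M.decomp x ≤ M.GtpXdd)
  {S₀ : Subgroup M.PiTemp} (hS₀ : S₀ ∈ (cuspPairOf M.toTemperedCurve x).splittings)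

section Produced

variable [T1Space M.GtpC]
  (κ : haveI := isMulCommutative_pushforward_I e hx
    haveI := ((cuspPairOf M.toTemperedCurve x).pushforward M.inclX).ID_normal
    KxHat M.toTemperedCurve ≃*
      ↥(ContH1.resKer ((cuspPairOf M.toTemperedCurve x).pushforward M.inclX).ID
        (⊤ : Subgroup ((cuspPairOf M.toTemperedCurve x).pushforward M.inclX).D)
        (((cuspPairOf M.toTemperedCurve x).pushforward M.inclX).isClosedComplement_of_mem_splittings
          (map_inclX_mem_splittings e hS₀)).le_left))

/-- The produced datum records the cusp `x` itself … [cite: MochizukiEtTh2009, Thm 1.10 (iii) p.30] -/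
@[simp] theorem ofStructureGroupIso_cusp : (ofStructureGroupIso e εZ hx hD hS₀ κ).cusp = x := rfl

/-- … with conjugating element `1` … [cite: MochizukiEtTh2009, Thm 1.10 (iii) p.30] -/
@[simp] theorem ofStructureGroupIso_conj : (ofStructureGroupIso e εZ hx hD hS₀ κ).conj = 1 := rfl

/-- … and decomposition group `inclX(D_x)`. [cite: MochizukiEtTh2009, Thm 1.10 (iii) p.30] -/
theorem ofStructureGroupIso_pair_D : (ofStructureGroupIso e εZ hx hD hS₀ κ).pair.D = (M.decomp x).map M.inclX := rfl

/-- **(ct) at the produced datum, positive half**: if `D_x` is commensurably terminal in `Π^tp_X`, `ε_±` conjugates `inclX(D_x)` through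
`Γ₀ ∈ Π^tp_X`, and `g₁ := inclX(Γ₀)·ε_± ∉ Π^tp_Ċ`, then every element of `Π^tp_Ċ` commensurating the decomposition group of the produced cusp
datum lies in it (binder `hCTα`/`hCTβ` of the v3 closers). [cite: MochizukiSemiAnbd2006, Thm 6.5 (ii) p.71] -/
theorem ofStructureGroupIso_hCT (hCT : IsCommensurablyTerminal (M.decomp x)) {Γ₀ : M.PiTemp}
    (hΓ₀ : ∀ d ∈ M.decomp x, M.epsPM * M.inclX d * M.epsPM⁻¹ = M.inclX (Γ₀⁻¹ * d * Γ₀))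
    (hnot : M.inclX Γ₀ * M.epsPM ∉ M.dotC εZ) :
    ∀ g ∈ M.dotC εZ, Subgroup.Commensurable (MulAut.conj g • (ofStructureGroupIso e εZ hx hD hS₀ κ).pair.D)
      (ofStructureGroupIso e εZ hx hD hS₀ κ).pair.D → g ∈ (ofStructureGroupIso e εZ hx hD hS₀ κ).pair.D :=
  MuTwoSetting.commTerminalC_of_sqrt_not_mem_dotC hCT hΓ₀ hD hnot

/-- **(ct) at the produced datum, negative half**: if `g₁ ∈ Π^tp_Ċ` then (ct) FAILS there (`g₁` centralises `inclX(D_x)` without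
belonging to it). [cite: MochizukiSemiAnbd2006, Thm 6.5 (ii) p.71] -/
theorem ofStructureGroupIso_not_hCT {Γ₀ : M.PiTemp}
    (hΓ₀ : ∀ d ∈ M.decomp x, M.epsPM * M.inclX d * M.epsPM⁻¹ = M.inclX (Γ₀⁻¹ * d * Γ₀))
    (hmem : M.inclX Γ₀ * M.epsPM ∈ M.dotC εZ) :
    ¬ ∀ g ∈ M.dotC εZ, Subgroup.Commensurable (MulAut.conj g • (ofStructureGroupIso e εZ hx hD hS₀ κ).pair.D)
      (ofStructureGroupIso e εZ hx hD hS₀ κ).pair.D → g ∈ (ofStructureGroupIso e εZ hx hD hS₀ κ).pair.D :=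
  MuTwoSetting.not_commTerminalC_of_sqrt_mem_dotC hΓ₀ hmem

/-- **(ct) at the produced datum IS the `ε_±`-criterion** (abc-iut-L2-t5's `commTerminalC_iff_sqrt_not_mem_dotC` read at the produced
cusp pair): given [SemiAnbd] Thm. 6.5 (ii) for `D_x ≤ Π^tp_X` and `Γ₀`, (ct) ⟺ `inclX(Γ₀)·ε_± ∉ Π^tp_Ċ`. [cite: MochizukiSemiAnbd2006, Thm 6.5 (ii) p.71] -/
theorem ofStructureGroupIso_hCT_iff (hCT : IsCommensurablyTerminal (M.decomp x)) {Γ₀ : M.PiTemp}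
    (hΓ₀ : ∀ d ∈ M.decomp x, M.epsPM * M.inclX d * M.epsPM⁻¹ = M.inclX (Γ₀⁻¹ * d * Γ₀)) :
    (∀ g ∈ M.dotC εZ, Subgroup.Commensurable (MulAut.conj g • (ofStructureGroupIso e εZ hx hD hS₀ κ).pair.D)
      (ofStructureGroupIso e εZ hx hD hS₀ κ).pair.D → g ∈ (ofStructureGroupIso e εZ hx hD hS₀ κ).pair.D) ↔
      M.inclX Γ₀ * M.epsPM ∉ M.dotC εZ :=
  MuTwoSetting.commTerminalC_iff_sqrt_not_mem_dotC hCT hΓ₀ hD εZ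

/-- **(gen) at the produced datum in the closer's binder shape**, for the base splitting `inclX(S₀)`.
[cite: MochizukiGalSect2005, §4 p.33] -/
theorem ofStructureGroupIso_hgen :
    haveI := (ofStructureGroupIso e εZ hx hD hS₀ κ).isMulCommutative_I
    haveI := (ofStructureGroupIso e εZ hx hD hS₀ κ).pair.ID_normal
    ∃ κ' : KxHat M.toThetaSetting.toTemperedCurve ≃*
        ↥(ContH1.resKer (ofStructureGroupIso e εZ hx hD hS₀ κ).pair.ID (⊤ : Subgroup (ofStructureGroupIso e εZ hx hD hS₀ κ).pair.D)
          ((ofStructureGroupIso e εZ hx hD hS₀ κ).pair.isClosedComplement_of_mem_splittings (map_inclX_mem_splittings e hS₀)).le_left),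
      ∀ k cl, (ofStructureGroupIso e εZ hx hD hS₀ κ).torsor.act k cl =
        ((ofStructureGroupIso e εZ hx hD hS₀ κ).pair.torsorDataH1 (ofStructureGroupIso e εZ hx hD hS₀ κ).isClosed_D
          (ofStructureGroupIso e εZ hx hD hS₀ κ).isCompact_I (map_inclX_mem_splittings e hS₀)).act (κ' k) cl :=
  isGenuineTorsor_ofStructureGroupIso e εZ hx hD hS₀ κ (map_inclX_mem_splittings e hS₀)

end Produced

end DotCCusp

end MuTwoSetting

/-! ### The closer of record at the produced data -/

section EndKnitProduced

variable {p : ℕ} [Fact p.Prime] {Mα Mβ : MuTwoSetting p} {εα : Mα.GtpC} {εβ : Mβ.GtpC}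
  {hCα : Mα.toThetaSetting.Compat} {hCβ : Mβ.toThetaSetting.Compat}
  {Eα : Mα.toThetaSetting.EtaleThetaData} {Eβ : Mβ.toThetaSetting.EtaleThetaData}
  {γ : Mα.dotC εα ≃ₜ* Mβ.dotC εβ}

open MuTwoSetting MuTwoSetting.DotCCusp in
/-- **[EtTh] Thm. 1.10 (iii) AS TYPED at the two PRODUCED cusp data** (`ofStructureGroupIso` on both sides): the closer of record
`thm110iiiGalSect_of_Xlevel_v3` with (gen) ×2, (sf) ×2 and the base splittings DISCHARGED by construction and (ct) ×2 REPLACED by the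
inputs of the `ε_±`-criterion.  Remaining inputs, all BY NAME: (x) the `Ẋ`-level cusp transport along `γ_X` (`σ` with `inclX σ ∈ Π^tp_Ċβ`);
per side [SemiAnbd] Thm. 6.5 (ii) for `D_x`, the conjugator `Γ₀` of `ε_±` on `inclX(D_x)` and `inclX(Γ₀)·ε_± ∉ Π^tp_Ċ`; F-0007 = [AbsAnab]
Lem. 1.3.8 `PreservesGeom` with its modelling data; (b3) [GalSect] Cor. 4.12 for the class transports along `Γ ∘ Inn c`.
[cite: MochizukiEtTh2009, Thm 1.10 (iii) p.30] -/
theorem thm110iiiGalSect_ofStructureGroupIso [T1Space Mα.GtpC] [T1Space Mβ.GtpC]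
    (H : Thm110Hypothesis εα εβ hCα hCβ Eα Eβ γ)
    (Sα : Mα.StandardData Eα.toKummerData) (Sβ : Mβ.StandardData Eβ.toKummerData)
    -- the produced cusp data, side α
    (eα : Mα.CLevelData) {xα : Mα.Pt} (hxα : Mα.IsCusp xα) (hDα : Mα.decomp xα ≤ Mα.GtpXdd)
    {S₀α : Subgroup Mα.PiTemp} (hS₀α : S₀α ∈ (cuspPairOf Mα.toTemperedCurve xα).splittings)
    (κα : haveI := isMulCommutative_pushforward_I eα hxα
      haveI := ((cuspPairOf Mα.toTemperedCurve xα).pushforward Mα.inclX).ID_normal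
      KxHat Mα.toTemperedCurve ≃*
        ↥(ContH1.resKer ((cuspPairOf Mα.toTemperedCurve xα).pushforward Mα.inclX).ID
          (⊤ : Subgroup ((cuspPairOf Mα.toTemperedCurve xα).pushforward Mα.inclX).D)
          (((cuspPairOf Mα.toTemperedCurve xα).pushforward Mα.inclX).isClosedComplement_of_mem_splittings
            (map_inclX_mem_splittings eα hS₀α)).le_left))
    -- the produced cusp data, side β
    (eβ : Mβ.CLevelData) {xβ : Mβ.Pt} (hxβ : Mβ.IsCusp xβ) (hDβ : Mβ.decomp xβ ≤ Mβ.GtpXdd)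
    {S₀β : Subgroup Mβ.PiTemp} (hS₀β : S₀β ∈ (cuspPairOf Mβ.toTemperedCurve xβ).splittings)
    (κβ : haveI := isMulCommutative_pushforward_I eβ hxβ
      haveI := ((cuspPairOf Mβ.toTemperedCurve xβ).pushforward Mβ.inclX).ID_normal
      KxHat Mβ.toTemperedCurve ≃*
        ↥(ContH1.resKer ((cuspPairOf Mβ.toTemperedCurve xβ).pushforward Mβ.inclX).ID
          (⊤ : Subgroup ((cuspPairOf Mβ.toTemperedCurve xβ).pushforward Mβ.inclX).D)
          (((cuspPairOf Mβ.toTemperedCurve xβ).pushforward Mβ.inclX).isClosedComplement_of_mem_splittings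
            (map_inclX_mem_splittings eβ hS₀β)).le_left))
    -- (x) the `Ẋ`-level cusp transport along `γ_X`
    {σ : Mβ.PiTemp} (hσ : Mβ.inclX σ ∈ Mβ.dotC εβ)
    (hX : (Mα.decomp xα).map H.γX.toMulEquiv.toMonoidHom = MulAut.conj σ • Mβ.decomp xβ)
    -- (ct) ×2 as the inputs of the `ε_±`-criterion
    (hCTα : IsCommensurablyTerminal (Mα.decomp xα)) {Γ₀α : Mα.PiTemp}
    (hΓ₀α : ∀ d ∈ Mα.decomp xα, Mα.epsPM * Mα.inclX d * Mα.epsPM⁻¹ = Mα.inclX (Γ₀α⁻¹ * d * Γ₀α))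
    (hnotα : Mα.inclX Γ₀α * Mα.epsPM ∉ Mα.dotC εα)
    (hCTβ : IsCommensurablyTerminal (Mβ.decomp xβ)) {Γ₀β : Mβ.PiTemp}
    (hΓ₀β : ∀ d ∈ Mβ.decomp xβ, Mβ.epsPM * Mβ.inclX d * Mβ.epsPM⁻¹ = Mβ.inclX (Γ₀β⁻¹ * d * Γ₀β))
    (hnotβ : Mβ.inclX Γ₀β * Mβ.epsPM ∉ Mβ.dotC εβ)
    -- (ΔX) BY NAME: [AbsAnab] Lem. 1.3.8 = FACT F-0007 `PreservesGeom`
    (Fα Fβ : Literature.AnabelianGeometry.AbsoluteAnabelian.FundamentalExtension.{0})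
    (fα : Fα.arith ≃ₜ* Mα.PiHat) (fβ : Fβ.arith ≃ₜ* Mβ.PiHat)
    (hfα : Fα.geom.map fα.toMulEquiv.toMonoidHom = Mα.DeltaHat)
    (hfβ : Fβ.geom.map fβ.toMulEquiv.toMonoidHom = Mβ.DeltaHat)
    (h138 : ∀ Φ : Mα.PiHat ≃ₜ* Mβ.PiHat, (∀ y : Mα.PiTemp, Φ (Mα.toHat y) = Mβ.toHat (H.γX y)) →
      Literature.AnabelianGeometry.AbsoluteAnabelian.FundamentalExtension.PreservesGeom (F := Fβ)
        (fα.trans (Φ.trans fβ.symm)))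
    -- (b3) [GalSect] Cor. 4.12 for the class transports along `Γ ∘ Inn c`, every `c ∈ Π^tp_{Ċβ}`
    (hecan : ∀ c ∈ Mβ.dotC εβ,
      ∀ (t : (ofStructureGroupIso eα εα hxα hDα hS₀α κα).pair.SplittingClass →
        (ofStructureGroupIso eβ εβ hxβ hDβ hS₀β κβ).pair.SplittingClass),
      (∀ (S : Subgroup Mα.GtpC) (hS : S ∈ (ofStructureGroupIso eα εα hxα hDα hS₀α κα).pair.splittings),
        ∃ h', t (GalSect.CuspPair.SplittingClass.mk (ofStructureGroupIso eα εα hxα hDα hS₀α κα).pair S hS) =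
          GalSect.CuspPair.SplittingClass.mk (ofStructureGroupIso eβ εβ hxβ hDβ hS₀β κβ).pair
            (S.map (H.Γ.trans (Mβ.innerAutC c)).toMulEquiv.toMonoidHom) h') →
      t '' (ofStructureGroupIso eα εα hxα hDα hS₀α κα).canonical ⊆ (ofStructureGroupIso eβ εβ hxβ hDβ hS₀β κβ).canonical) :
    Thm110iiiGalSect H Sα Sβ (ofStructureGroupIso eα εα hxα hDα hS₀α κα) (ofStructureGroupIso eβ εβ hxβ hDβ hS₀β κβ) := by
  refine thm110iiiGalSect_of_Xlevel_v3 H Sα Sβ _ _ hσ ?_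
    (ofStructureGroupIso_hCT eα εα hxα hDα hS₀α κα hCTα hΓ₀α hnotα)
    (ofStructureGroupIso_hCT eβ εβ hxβ hDβ hS₀β κβ hCTβ hΓ₀β hnotβ)
    Fα Fβ fα fβ hfα hfβ h138
    (hsf_ofStructureGroupIso eα εα hxα hDα hS₀α κα) (hsf_ofStructureGroupIso eβ εβ hxβ hDβ hS₀β κβ)
    (map_inclX_mem_splittings eα hS₀α) (map_inclX_mem_splittings eβ hS₀β)
    (ofStructureGroupIso_hgen eα εα hxα hDα hS₀α κα) (ofStructureGroupIso_hgen eβ εβ hxβ hDβ hS₀β κβ) hecan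
  -- (x): the produced data record the cusps themselves with conjugating elements `1`
  simp only [ofStructureGroupIso_conj, ofStructureGroupIso_cusp, map_one, one_smul]
  exact hX

end EndKnitProduced

/-! ### Instance column: the typed Thm. 1.10 (iii) at a produced datum of a JOINT ORIGIN, identity hypothesis structure -/

section Origins

variable {p : ℕ} [Fact p.Prime]

/-- **INSTANCE at a JOINT ORIGIN (γ = id).**  At a `MuTwoSetting` that is a joint origin (`IsEtThOrigin` + `hYcl` + `IsThm16Origin` +
`IsTateOrigin` + `CuspLaws`) with a C-level datum `e`, for every admissible `ε_Z`, `Compat`, étale theta datum, standard data and the cusp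
`x` with (P3) `D_x ≤ Π^tp_Y` and `D_x ≤ Π^tp_Ẍ`: there is a cusp datum `C` over `(inclX D_x, inclX I_x)` carrying (gen), C7e (1) and (sf),
and a hypothesis structure over the identity `γ`, for which [EtTh] Thm. 1.10 (iii) AS TYPED holds.  (Consistency / instance-column
evidence: `γ = id`; joint origins are inhabited at no carrier of the model zoo.) [cite: MochizukiEtTh2009, Thm 1.10 (iii) p.30] -/
theorem exists_produced_thm110iiiGalSect_refl_of_origins (M : MuTwoSetting p) (e : M.CLevelData) {εZ : M.GtpC}
    (hZ : M.IsAdmissibleEpsZ εZ) (hC : M.toThetaSetting.Compat) (E : M.toThetaSetting.EtaleThetaData)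
    (S : M.StandardData E.toKummerData) {x : M.Pt} (hx : M.IsCusp x) (hD : M.decomp x ≤ M.GtpXdd)
    (hO : M.IsEtThOrigin)
    (hYcl : (M.DtpY.map M.toHat.toMonoidHom).topologicalClosure ≤
      M.DtpY.map M.toHat.toMonoidHom ⊔ (⁅⁅M.DeltaHat, M.DeltaHat⁆, M.DeltaHat⁆).topologicalClosure)
    (h16 : M.IsThm16Origin) (hT : M.IsTateOrigin) (hL : M.CuspLaws) (hP3 : M.decomp x ≤ M.GtpY) :
    haveI := M.t1Space_GtpC e
    ∃ (C : M.DotCCusp εZ) (H : Thm110Hypothesis εZ εZ hC hC E E (ContinuousMulEquiv.refl (M.dotC εZ))),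
      C.IsGenuineTorsor ∧ C.IsCyclotomicInertia ∧ (∀ g : M.GtpC, ∃ h : M.PiTemp, C.augC g = M.aug h) ∧
        C.pair = (GalSect.cuspPairOf M.toTemperedCurve x).pushforward M.inclX ∧ Thm110iiiGalSect H S S C C := by
  haveI := M.t1Space_GtpC e
  obtain ⟨C, hgen, hcyc, hsf, hpair⟩ :=
    MuTwoSetting.DotCCusp.exists_isGenuineTorsor_hsf_of_origins e εZ hx hD hO hYcl h16 hT hL hP3
  obtain ⟨H, hH⟩ := exists_thm110iiiGalSect_refl M hZ hC E S C C.canonical_isStructure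
  exact ⟨C, H, hgen, hcyc, hsf, hpair, hH⟩

end Origins

end Literature.AnabelianGeometry.EtaleTheta
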